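import Literature.MathematicalPhysics.QuantumLattice.HubbardOpenBoxPlaquetteDressedBound
import Literature.MathematicalPhysics.QuantumLattice.HubbardNNNHopping
import HarnessLib

/-!
# The plaquette-dressed Slater bound on the even rectangular TORUS with `t–t'` hopping

Topic `MathematicalPhysics/QuantumLattice`, family `hubbard`. The periodic, next-nearest-neighbour
companion of `HubbardRectTorusPlaquetteDressedBound.lean` (`t' = 0`, torus) and
`HubbardOpenBoxPlaquetteDressedBound.lean` (`t–t'`, open box): the abstract dressed-cluster
(local-unitary-cluster, LUC) variational bound `DressedCluster.groundEnergy_le` instantiated for the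
`t–t'` Hubbard Hamiltonian of the rectangular torus `hubbardRectTorusTT' (M * 2) (M' * 2) t t' U`
(`HubbardNNNHopping.lean`; vertex set `Fin (2M) ×ₗ Fin (2M')`, nearest-neighbour bonds
`fermionRectTorusGraph`, diagonal bonds `fermionRectTorusDiagGraph`, ring adjacency `ringAdj` of
representatives), tiled by the `M · M'` disjoint `2 × 2` plaquettes `rectCellSite c ·`
(`c ∈ ℤ/M × ℤ/M'`, the charts of the rectangular file), `M, M' ≥ 2`. This is the
`TODO(general form)` recorded in the module docstring of the rectangular file. The bonds between
plaquettes come in two kinds, exactly as for the open box but with wrap-around: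

* AXIAL links `ℓ = (c, e)`, window = plaquettes `c` (first copy) and `c + e` (second copy), chart
  `rectLinkEmb c e` of the rectangular file: the two nearest-neighbour middle bonds
  (`PlaquetteLUC.linkGraph e`) AND the two diagonal bonds between the facing sides
  (`PlaquetteLUC.linkDiagGraph e` of the open-box file);
* CORNER links `ℓ = (c, d)`, window = plaquettes `c` and `rectCornerShift c d = c + (1, 1)` (`d = 0`)
  resp. `c + (1, -1)` (`d = 1`), chart `rectCornerEmb c d`: the single diagonal bond between the
  facing corners (`PlaquetteLUC.cornerGraph d`);

and inside a plaquette the two diagonals form `PlaquetteLUC.plaquetteDiagGraph`. Results: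

* `rectTT'_hamiltonian_eq_sum_cells_add_sum_links` (private) — **bond partition**
  `H_{2M×2M'}(t,t',U) = Σ_c Γ(cell c)(H_plaq(t,U) + D_plaq(t'))
     + Σ_{(c,e)} Γ(link c e)(T_e(t) + D_e(t')) + Σ_{(c,d)} Γ(corner c d) C_d(t')`:
  for `M, M' ≥ 2` every nearest-neighbour bond of the torus lies in exactly one plaquette or one
  axial link, every diagonal bond in exactly one plaquette, one axial link or one corner link
  (for a side of length `4`, i.e. `M = 2` or `M' = 2`, the plaquettes `c + e` and `c - e` coincide
  but the bonds `(2c+1) → (2c+2)` and `(2c) → (2c-1)` do not, and the count is still exact);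
* `groundEnergy_rectTT'_le_dressed` — **the bound**: for every orthogonal projection `P` on the
  one-particle space of the torus with `tr P = N` and every family of particle-number conserving
  unitaries `u_c` of the plaquette Fock space,
  `E_{2M×2M'}(t,t',U; N) ≤ Re [ Σ_c Σ_{s,t} (u_cᴴ (H_plaq + D_plaq) u_c)_{st} ρ_P^{cell c}(s,t)
     + Σ_{(c,e)} Σ_{s,t} (V_{c,e}ᴴ (T_e + D_e) V_{c,e})_{st} ρ_P^{link c,e}(s,t)
     + Σ_{(c,d)} Σ_{s,t} (W_{c,d}ᴴ C_d W_{c,d})_{st} ρ_P^{corner c,d}(s,t) ]`,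
  `V_{c,e} = Γ(inl) u_c · Γ(inr) u_{c+e}`, `W_{c,d} = Γ(inl) u_c · Γ(inr) u_{rectCornerShift c d}`,
  `ρ_P^φ = slaterRDM (P|_φ)` — an explicit polynomial in the window entries of `P` and the
  entries of the `u_c`; at `t' = 0` the diagonal window operators vanish and this is
  `PlaquetteLUC.groundEnergyAt_rect_le_dressed`.

This is the soundness statement behind exact-ℚ "torus plaquette-LUC" upper certificates for the
`t–t'` model, in particular translation-invariant ones (one `16k × 16k` torus certificate for every
`k`, hence a thermodynamic-limit upper bound with no boundary term). Sources: Bach–Lieb–Solovej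
1994, eq. (2c.36) (variational principle for quasi-free states and their unitary dressings)
[BachLiebSolovej1994]; Bratteli–Robinson II §5.2.2 (CAR algebra, even subalgebras commute at
disjoint support) [BratteliRobinsonII1997]; LeBlanc et al. 2015, eq. (1) (the `t–t'` model and
the periodic benchmark geometries) [LeBlancEtAl2015]; the tiling is elementary [folklore].
Everything is proved; definitions have bodies; no named facts. The tiling lemmas are file-private
plumbing (the private cell-coordinate lemmas of the two companion files are re-derived here in
the form `representatives + omega`); Literature exports only the cited bound and the corner charts
it is stated with.
-/

noncomputable section

namespace Literature.MathematicalPhysics.QuantumLattice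

open Matrix Finset HubbardWave0 Literature.Probability.LatticeModels
open scoped ComplexOrder Function

namespace PlaquetteLUC

variable {M M' : ℕ}

/-! ### §1. Cell coordinates on the torus (charts of the rectangular file) -/

/-- First coordinate of a cell site. [folklore] -/
@[simp] private theorem ofLex_rectCellSite_fst'' (c : Fin M × Fin M') (a : FermionTorus 2 2) :
    (ofLex (rectCellSite c a)).1 = finProdFinEquiv (c.1, ofLex a 0) := rfl

/-- Second coordinate of a cell site. [folklore] -/
@[simp] private theorem ofLex_rectCellSite_snd'' (c : Fin M × Fin M') (a : FermionTorus 2 2) :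
    (ofLex (rectCellSite c a)).2 = finProdFinEquiv (c.2, ofLex a 1) := rfl

/-- Two offsets of `{0,1}²` agree iff both coordinates agree. [folklore] -/
private theorem offset_eq_iff'' (a b : FermionTorus 2 2) : a = b ↔ ofLex a 0 = ofLex b 0 ∧ ofLex a 1 = ofLex b 1 := by
  constructor
  · rintro rfl; exact ⟨rfl, rfl⟩
  · rintro ⟨h0, h1⟩
    refine ofLex.injective (funext fun i => ?_)
    fin_cases i
    · exact h0
    · exact h1

/-- `rectCellSite` is jointly injective. [folklore] -/
private theorem rectCellSite_inj'' {c c' : Fin M × Fin M'} {a b : FermionTorus 2 2} :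
    rectCellSite c a = rectCellSite c' b ↔ c = c' ∧ a = b := by
  constructor
  · intro h
    have h1 := congrArg (fun p => (ofLex p).1) h
    have h2 := congrArg (fun p => (ofLex p).2) h
    simp only [ofLex_rectCellSite_fst'', ofLex_rectCellSite_snd'', EmbeddingLike.apply_eq_iff_eq,
      Prod.mk.injEq] at h1 h2
    exact ⟨Prod.ext h1.1 h2.1, (offset_eq_iff'' a b).2 ⟨h1.2, h2.2⟩⟩
  · rintro ⟨rfl, rfl⟩; rfl

/-- Cell coordinates are a bijection `(ℤ/M × ℤ/M') × {0,1}² → (ℤ/2M) × (ℤ/2M')`. [folklore] -/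
private theorem rectCellSite_bijective'' :
    Function.Bijective (fun p : (Fin M × Fin M') × FermionTorus 2 2 => rectCellSite p.1 p.2) := by
  rw [Fintype.bijective_iff_injective_and_card]
  refine ⟨fun p q h => Prod.ext (rectCellSite_inj''.1 h).1 (rectCellSite_inj''.1 h).2, ?_⟩
  rw [Fintype.card_prod, Fintype.card_prod, Fintype.card_fin, Fintype.card_fin, card_rectSites]
  change M * M' * Fintype.card (Fin 2 → Fin 2) = _
  rw [Fintype.card_fun, Fintype.card_fin]
  ring

/-- `rectCellEmb c a = rectCellSite c a`. [folklore] -/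
@[simp] private theorem rectCellEmb_apply'' (c : Fin M × Fin M') (a : FermionTorus 2 2) :
    rectCellEmb c a = rectCellSite c a := rfl

/-- Distinct plaquettes are disjoint. [folklore] -/
private theorem disjoint_rectCellEmb'' {c c' : Fin M × Fin M'} (h : c ≠ c') :
    Disjoint ((univ : Finset (FermionTorus 2 2)).map (rectCellEmb c)) (univ.map (rectCellEmb c')) := by
  rw [Finset.disjoint_left]
  rintro x hx hx'
  obtain ⟨a, -, rfl⟩ := Finset.mem_map.1 hx
  obtain ⟨b, -, hb⟩ := Finset.mem_map.1 hx'
  exact h (rectCellSite_inj''.1 hb).1.symm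

/-- `pairSite c c'` (first copy `c`, second copy `c'`) is injective for distinct plaquettes.
[folklore] -/
private theorem pairSite_injective'' {c c' : Fin M × Fin M'} (hcc : c ≠ c') :
    Function.Injective (pairSite c c') := by
  intro p q h
  rw [pairSite, pairSite, rectCellSite_inj''] at h
  obtain ⟨h1, h2⟩ := h
  have hi : (ofLex p).1 = (ofLex q).1 := by
    by_contra hne
    rcases Fin.eq_zero_or_eq_succ (ofLex p).1 with hp | ⟨k, hk⟩ <;>
      rcases Fin.eq_zero_or_eq_succ (ofLex q).1 with hq | ⟨l, hl⟩
    · exact hne (hp.trans hq.symm)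
    · rw [hp, hl, if_pos rfl, if_neg (Fin.succ_ne_zero l)] at h1
      exact hcc h1
    · rw [hk, hq, if_neg (Fin.succ_ne_zero k), if_pos rfl] at h1
      exact hcc h1.symm
    · apply hne; rw [hk, hl, Fin.eq_zero k, Fin.eq_zero l]
  exact ofLex.injective (Prod.ext hi h2)

variable [NeZero M] [NeZero M']

/-- `c + e₀ = (c₁ + 1, c₂)`. [folklore] -/
@[simp] private theorem rectShift_zero'' (c : Fin M × Fin M') : rectShift c 0 = (c.1 + 1, c.2) := by
  ext <;> simp [rectShift, rectDir]

/-- `c + e₁ = (c₁, c₂ + 1)`. [folklore] -/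
@[simp] private theorem rectShift_one'' (c : Fin M × Fin M') : rectShift c 1 = (c.1, c.2 + 1) := by
  ext <;> simp [rectShift, rectDir]

/-- **The diagonal steps of the plaquette index**: `(1, 1)` for `d = 0` and `(1, -1)` for `d = 1` —
the relative position, in plaquette units, of the two plaquettes of the torus joined by exactly one
next-nearest-neighbour bond `⟨⟨i,j⟩⟩` of the `t–t'` Hamiltonian of LeBlanc et al. (2015), eq. (1)
(periodic clusters). [cite: LeBlancEtAl2015, eq. (1)] -/
def rectCornerDir (d : Fin 2) : Fin M × Fin M' := (1, if d = 0 then 1 else -1)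

/-- The diagonally neighbouring plaquette index `c + (1, ±1)` (corner link of kind `d`).
[cite: LeBlancEtAl2015, eq. (1)] -/
def rectCornerShift (c : Fin M × Fin M') (d : Fin 2) : Fin M × Fin M' := c + rectCornerDir d

/-- `c + (1, 1)` unfolded. [folklore] -/
@[simp] private theorem rectCornerShift_zero (c : Fin M × Fin M') :
    rectCornerShift c 0 = (c.1 + 1, c.2 + 1) := by
  ext <;> simp [rectCornerShift, rectCornerDir]

/-- `c + (1, -1)` unfolded. [folklore] -/
@[simp] private theorem rectCornerShift_one (c : Fin M × Fin M') :
    rectCornerShift c 1 = (c.1 + 1, c.2 - 1) := by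
  ext <;> simp [rectCornerShift, rectCornerDir, sub_eq_add_neg]

omit [NeZero M'] in
/-- In `ℤ/M`, `M ≥ 2`, adding one moves. [folklore] -/
private theorem fin_add_one_ne'' (hM : 2 ≤ M) (x : Fin M) : x + 1 ≠ x := by
  intro h
  have h2 := congrArg Fin.val h
  rw [Fin.val_add, Fin.val_one', Nat.mod_eq_of_lt (by omega : 1 < M)] at h2
  have hx := x.isLt
  rcases Nat.lt_or_ge ((x : ℕ) + 1) M with hlt | hge
  · rw [Nat.mod_eq_of_lt hlt] at h2; omega
  · have heq : (x : ℕ) + 1 = M := by omega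
    rw [heq, Nat.mod_self] at h2; omega

/-- For `M, M' ≥ 2` a plaquette differs from its axial neighbours. [folklore] -/
private theorem rectShift_ne'' (hM : 2 ≤ M) (hM' : 2 ≤ M') (c : Fin M × Fin M') (e : Fin 2) :
    rectShift c e ≠ c := by
  intro h
  fin_cases e
  · exact fin_add_one_ne'' hM c.1 (by simpa using congrArg Prod.fst h)
  · exact fin_add_one_ne'' hM' c.2 (by simpa using congrArg Prod.snd h)

/-- For `M ≥ 2` a plaquette differs from its diagonal neighbours (the first coordinate moves).
[folklore] -/
private theorem rectCornerShift_ne (hM : 2 ≤ M) (c : Fin M × Fin M') (d : Fin 2) :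
    rectCornerShift c d ≠ c := by
  intro h
  have h1 := congrArg Prod.fst h
  simp only [rectCornerShift, rectCornerDir, Prod.fst_add] at h1
  exact fin_add_one_ne'' hM c.1 h1

/-- `rectLinkEmb` unfolded. [folklore] -/
@[simp] private theorem rectLinkEmb_apply'' (hM : 2 ≤ M) (hM' : 2 ≤ M') (c : Fin M × Fin M') (e : Fin 2)
    (p : Fin 2 ×ₗ FermionTorus 2 2) :
    rectLinkEmb hM hM' c e p = rectCellSite (if (ofLex p).1 = 0 then c else rectShift c e) (ofLex p).2 := rfl

/-- The first copy of an axial link window is the plaquette `c`. [folklore] -/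
private theorem inlCell_trans_rectLinkEmb'' (hM : 2 ≤ M) (hM' : 2 ≤ M') (c : Fin M × Fin M') (e : Fin 2) :
    inlCell.trans (rectLinkEmb hM hM' c e) = rectCellEmb c := by
  ext a
  simp [Function.Embedding.trans_apply]

/-- The second copy of an axial link window is the plaquette `c + e`. [folklore] -/
private theorem inrCell_trans_rectLinkEmb'' (hM : 2 ≤ M) (hM' : 2 ≤ M') (c : Fin M × Fin M') (e : Fin 2) :
    inrCell.trans (rectLinkEmb hM hM' c e) = rectCellEmb (rectShift c e) := by
  ext a
  simp [Function.Embedding.trans_apply]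

/-- **The chart of the corner link window** made of the plaquettes `c` (first copy) and
`c + (1, ±1)` (second copy): `(i, a) ↦ rectCellSite (c resp. rectCornerShift c d) a` (`M ≥ 2`, so that
the two plaquettes are distinct). [folklore] -/
def rectCornerEmb (hM : 2 ≤ M) (c : Fin M × Fin M') (d : Fin 2) :
    Fin 2 ×ₗ FermionTorus 2 2 ↪ Fin (M * 2) ×ₗ Fin (M' * 2) :=
  ⟨pairSite c (rectCornerShift c d), pairSite_injective'' (rectCornerShift_ne hM c d).symm⟩

/-- `rectCornerEmb` unfolded. [folklore] -/
@[simp] private theorem rectCornerEmb_apply (hM : 2 ≤ M) (c : Fin M × Fin M') (d : Fin 2) (p : Fin 2 ×ₗ FermionTorus 2 2) :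
    rectCornerEmb hM c d p = rectCellSite (if (ofLex p).1 = 0 then c else rectCornerShift c d) (ofLex p).2 := rfl

/-- The first copy of a corner link window is the plaquette `c`. [folklore] -/
private theorem inlCell_trans_rectCornerEmb (hM : 2 ≤ M) (c : Fin M × Fin M') (d : Fin 2) :
    inlCell.trans (rectCornerEmb (M' := M') hM c d) = rectCellEmb c := by
  ext a
  simp [Function.Embedding.trans_apply]

/-- The second copy of a corner link window is the plaquette `c + (1, ±1)`. [folklore] -/
private theorem inrCell_trans_rectCornerEmb (hM : 2 ≤ M) (c : Fin M × Fin M') (d : Fin 2) :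
    inrCell.trans (rectCornerEmb (M' := M') hM c d) = rectCellEmb (rectCornerShift c d) := by
  ext a
  simp [Function.Embedding.trans_apply]

/-! ### §2. Ring adjacency and plaquette steps on representatives -/

omit [NeZero M'] in
/-- `y = x + 1` in `ℤ/M` (`M ≥ 2`) on representatives: `y = x + 1` in `ℕ`, or the wrap-around
`x = M - 1`, `y = 0`. [folklore] -/
private theorem fin_eq_add_one_iff (hM : 2 ≤ M) (x y : Fin M) :
    y = x + 1 ↔ ((y : ℕ) = x + 1 ∨ ((x : ℕ) + 1 = M ∧ (y : ℕ) = 0)) := by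
  rw [Fin.ext_iff, Fin.val_add, Fin.val_one', Nat.mod_eq_of_lt (by omega : 1 < M)]
  rcases Nat.lt_or_ge ((x : ℕ) + 1) M with h | h
  · rw [Nat.mod_eq_of_lt h]; omega
  · rw [show (x : ℕ) + 1 = M by omega, Nat.mod_self]; omega

omit [NeZero M'] in
/-- `y = x - 1` in `ℤ/M` (`M ≥ 2`) on representatives. [folklore] -/
private theorem fin_eq_sub_one_iff (hM : 2 ≤ M) (x y : Fin M) :
    y = x - 1 ↔ ((x : ℕ) = y + 1 ∨ ((y : ℕ) + 1 = M ∧ (x : ℕ) = 0)) := by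
  rw [eq_sub_iff_add_eq, show (y + 1 = x ↔ x = y + 1) from eq_comm]
  exact fin_eq_add_one_iff hM y x

/-- `c' = c + e₀` on representatives. [folklore] -/
private theorem eq_rectShift_zero_iff_val (hM : 2 ≤ M) (c c' : Fin M × Fin M') :
    c' = rectShift c 0 ↔
      ((c'.1 : ℕ) = c.1 + 1 ∨ ((c.1 : ℕ) + 1 = M ∧ (c'.1 : ℕ) = 0)) ∧ (c'.2 : ℕ) = c.2 := by
  simp only [rectShift_zero'', Prod.ext_iff, fin_eq_add_one_iff hM, Fin.ext_iff (n := M')]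

/-- `c' = c + e₁` on representatives. [folklore] -/
private theorem eq_rectShift_one_iff_val (hM' : 2 ≤ M') (c c' : Fin M × Fin M') :
    c' = rectShift c 1 ↔
      (c'.1 : ℕ) = c.1 ∧ ((c'.2 : ℕ) = c.2 + 1 ∨ ((c.2 : ℕ) + 1 = M' ∧ (c'.2 : ℕ) = 0)) := by
  simp only [rectShift_one'', Prod.ext_iff, fin_eq_add_one_iff hM', Fin.ext_iff (n := M)]

/-- `c' = c + (1, 1)` on representatives. [folklore] -/
private theorem eq_rectCornerShift_zero_iff_val (hM : 2 ≤ M) (hM' : 2 ≤ M') (c c' : Fin M × Fin M') :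
    c' = rectCornerShift c 0 ↔
      ((c'.1 : ℕ) = c.1 + 1 ∨ ((c.1 : ℕ) + 1 = M ∧ (c'.1 : ℕ) = 0)) ∧
        ((c'.2 : ℕ) = c.2 + 1 ∨ ((c.2 : ℕ) + 1 = M' ∧ (c'.2 : ℕ) = 0)) := by
  simp only [rectCornerShift_zero, Prod.ext_iff, fin_eq_add_one_iff hM, fin_eq_add_one_iff hM']

/-- `c' = c + (1, -1)` on representatives. [folklore] -/
private theorem eq_rectCornerShift_one_iff_val (hM : 2 ≤ M) (hM' : 2 ≤ M') (c c' : Fin M × Fin M') :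
    c' = rectCornerShift c 1 ↔
      ((c'.1 : ℕ) = c.1 + 1 ∨ ((c.1 : ℕ) + 1 = M ∧ (c'.1 : ℕ) = 0)) ∧
        ((c.2 : ℕ) = c'.2 + 1 ∨ ((c'.2 : ℕ) + 1 = M' ∧ (c.2 : ℕ) = 0)) := by
  simp only [rectCornerShift_one, Prod.ext_iff, fin_eq_add_one_iff hM, fin_eq_sub_one_iff hM']

omit [NeZero M] [NeZero M'] in
/-- Equality of plaquette indices on representatives. [folklore] -/
private theorem prod_eq_iff_val (c c' : Fin M × Fin M') :
    c' = c ↔ (c'.1 : ℕ) = c.1 ∧ (c'.2 : ℕ) = c.2 := by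
  rw [Prod.ext_iff, Fin.ext_iff, Fin.ext_iff]

omit [NeZero M] [NeZero M'] in
/-- **Ring adjacency in cell form, on representatives** (one coordinate `u = a + 2c` of a ring
`ℤ/2M`, `M ≥ 2`): `u ~ v` iff the two sites are the two offsets of one cell, or the bond
`(c, 1) ~ (c + 1, 0)` between consecutive cells in either orientation (with the wrap-around
`c = M - 1`, `c + 1 = 0` spelled out). [folklore] -/
private theorem ringAdj_cell_iff_val (hM : 2 ≤ M) (c c' : Fin M) (a b : Fin 2) :
    ringAdj (M * 2) ((finProdFinEquiv (c, a) : Fin (M * 2)) : ℕ) ((finProdFinEquiv (c', b) : Fin (M * 2)) : ℕ) ↔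
      ((c' : ℕ) = c ∧ a ≠ b) ∨
        (a = 1 ∧ b = 0 ∧ ((c' : ℕ) = c + 1 ∨ ((c : ℕ) + 1 = M ∧ (c' : ℕ) = 0))) ∨
          (b = 1 ∧ a = 0 ∧ ((c : ℕ) = c' + 1 ∨ ((c' : ℕ) + 1 = M ∧ (c : ℕ) = 0))) := by
  have ha := a.isLt; have hb := b.isLt; have hc := c.isLt; have hc' := c'.isLt
  simp only [ringAdj, finProdFinEquiv_apply_val, ne_eq, Fin.ext_iff, Fin.val_zero, Fin.val_one]
  have hmod1 : ((a : ℕ) + 2 * c + 1) % (M * 2) =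
      if (a : ℕ) + 2 * c + 1 < M * 2 then (a : ℕ) + 2 * c + 1 else 0 := by
    split_ifs with h
    · exact Nat.mod_eq_of_lt h
    · rw [show (a : ℕ) + 2 * c + 1 = M * 2 by omega, Nat.mod_self]
  have hmod2 : ((b : ℕ) + 2 * c' + 1) % (M * 2) =
      if (b : ℕ) + 2 * c' + 1 < M * 2 then (b : ℕ) + 2 * c' + 1 else 0 := by
    split_ifs with h
    · exact Nat.mod_eq_of_lt h
    · rw [show (b : ℕ) + 2 * c' + 1 = M * 2 by omega, Nat.mod_self]
  rw [hmod1, hmod2]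
  split_ifs <;> omega

/-- Adjacency in the plaquette diagonal graph, unfolded. [folklore] -/
private theorem plaquetteDiagGraph_adj'' (a b : FermionTorus 2 2) :
    plaquetteDiagGraph.Adj a b ↔ ofLex a 0 ≠ ofLex b 0 ∧ ofLex a 1 ≠ ofLex b 1 := Iff.rfl

/-- Adjacency in the diagonal link graph, unfolded. [folklore] -/
private theorem linkDiagGraph_adj'' (e : Fin 2) (p q : Fin 2 ×ₗ FermionTorus 2 2) :
    (linkDiagGraph e).Adj p q ↔ ((ofLex p).1 = 0 ∧ (ofLex q).1 = 1 ∧ LinkDiag e (ofLex p).2 (ofLex q).2) ∨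
      ((ofLex p).1 = 1 ∧ (ofLex q).1 = 0 ∧ LinkDiag e (ofLex q).2 (ofLex p).2) := Iff.rfl

/-- Adjacency in the corner link graph, unfolded. [folklore] -/
private theorem cornerGraph_adj'' (d : Fin 2) (p q : Fin 2 ×ₗ FermionTorus 2 2) :
    (cornerGraph d).Adj p q ↔ ((ofLex p).1 = 0 ∧ (ofLex q).1 = 1 ∧ CornerPair d (ofLex p).2 (ofLex q).2) ∨
      ((ofLex p).1 = 1 ∧ (ofLex q).1 = 0 ∧ CornerPair d (ofLex q).2 (ofLex p).2) := Iff.rfl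

/-! ### §3. Torus adjacency in cell coordinates (pointwise bond partition) -/

section Pointwise

variable {β : Type*} [AddCommMonoid β]

/-- Every offset of `{0,1}²` is `![a₀, a₁]`. [folklore] -/
private theorem offset_cases (a : FermionTorus 2 2) : ∃ a0 a1 : Fin 2, a = toLex ![a0, a1] :=
  ⟨ofLex a 0, ofLex a 1, ofLex.injective (funext fun i => by fin_cases i <;> rfl)⟩

/-- **The indicator of nearest-neighbour torus adjacency splits over plaquette edges and axial
link bonds** (pointwise form of the tiling; the alternatives are mutually exclusive for
`M, M' ≥ 2`). [folklore] -/
private theorem ite_rectAdj_cellSite_eq (hM : 2 ≤ M) (hM' : 2 ≤ M') (c c' : Fin M × Fin M')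
    (a b : FermionTorus 2 2) (x : β) :
    (if (fermionRectTorusGraph (M * 2) (M' * 2)).Adj (rectCellSite c a) (rectCellSite c' b) then x else 0) =
      (if c' = c ∧ plaquetteGraph.Adj a b then x else 0) +
        ∑ e : Fin 2, ((if c' = rectShift c e ∧ LinkMid e a b then x else 0) +
          (if c = rectShift c' e ∧ LinkMid e b a then x else 0)) := by
  obtain ⟨a0, a1, rfl⟩ := offset_cases a
  obtain ⟨b0, b1, rfl⟩ := offset_cases b
  have h1 := c.1.isLt; have h2 := c.2.isLt; have h1' := c'.1.isLt; have h2' := c'.2.isLt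
  simp only [Fin.sum_univ_two, Fin.isValue, eq_rectShift_zero_iff_val hM, eq_rectShift_one_iff_val hM']
  simp only [fermionRectTorusGraph_adj_iff, ofLex_rectCellSite_fst'', ofLex_rectCellSite_snd'',
    ringAdj_cell_iff_val hM, ringAdj_cell_iff_val hM', EmbeddingLike.apply_eq_iff_eq, Prod.mk.injEq,
    prod_eq_iff_val, plaquetteGraph_adj, ne_eq, LinkMid, Fin.exists_fin_two,
    Fin.forall_fin_two, Fin.isValue, Fin.ext_iff (n := M), Fin.ext_iff (n := M'), ofLex_toLex,
    Matrix.cons_val_zero, Matrix.cons_val_one]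
  fin_cases a0 <;> fin_cases a1 <;> fin_cases b0 <;> fin_cases b1 <;> simp [-Fin.val_eq_zero_iff] <;>
    (try split_ifs) <;> first | rfl | (simp only [add_zero, zero_add]; done) | (exfalso; omega)

/-- **The indicator of diagonal torus adjacency splits over plaquette diagonals, axial-link
diagonals and corner bonds** (pointwise; mutually exclusive alternatives for `M, M' ≥ 2`).
[folklore] -/
private theorem ite_rectDiagAdj_cellSite_eq (hM : 2 ≤ M) (hM' : 2 ≤ M') (c c' : Fin M × Fin M')
    (a b : FermionTorus 2 2) (x : β) :
    (if (fermionRectTorusDiagGraph (M * 2) (M' * 2)).Adj (rectCellSite c a) (rectCellSite c' b) then x else 0) =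
      (if c' = c ∧ plaquetteDiagGraph.Adj a b then x else 0) +
        ∑ e : Fin 2, ((if c' = rectShift c e ∧ LinkDiag e a b then x else 0) +
          (if c = rectShift c' e ∧ LinkDiag e b a then x else 0)) +
        ∑ d : Fin 2, ((if c' = rectCornerShift c d ∧ CornerPair d a b then x else 0) +
          (if c = rectCornerShift c' d ∧ CornerPair d b a then x else 0)) := by
  obtain ⟨a0, a1, rfl⟩ := offset_cases a
  obtain ⟨b0, b1, rfl⟩ := offset_cases b
  have h1 := c.1.isLt; have h2 := c.2.isLt; have h1' := c'.1.isLt; have h2' := c'.2.isLt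
  simp only [Fin.sum_univ_two, Fin.isValue, eq_rectShift_zero_iff_val hM, eq_rectShift_one_iff_val hM',
    eq_rectCornerShift_zero_iff_val hM hM', eq_rectCornerShift_one_iff_val hM hM']
  simp only [fermionRectTorusDiagGraph_adj_iff, ofLex_rectCellSite_fst'', ofLex_rectCellSite_snd'',
    ringAdj_cell_iff_val hM, ringAdj_cell_iff_val hM', prod_eq_iff_val, plaquetteDiagGraph_adj'', ne_eq,
    LinkDiag, CornerPair, Fin.forall_fin_two, Fin.isValue, ofLex_toLex, Matrix.cons_val_zero,
    Matrix.cons_val_one]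
  fin_cases a0 <;> fin_cases a1 <;> fin_cases b0 <;> fin_cases b1 <;> simp [-Fin.val_eq_zero_iff] <;>
    (try split_ifs) <;> first | rfl | (simp only [add_zero, zero_add]; done) | (exfalso; omega)

end Pointwise

/-! ### §4. Tiling of the torus bonds -/

section Sums

variable {β : Type*} [AddCommMonoid β]

omit [NeZero M] [NeZero M'] in
/-- Summing over the torus in cell coordinates. [folklore] -/
private theorem sum_rectCellSite'' (f : Fin (M * 2) ×ₗ Fin (M' * 2) → β) :
    ∑ x, f x = ∑ c : Fin M × Fin M', ∑ a : FermionTorus 2 2, f (rectCellSite c a) := by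
  rw [← rectCellSite_bijective''.sum_comp f, Fintype.sum_prod_type]

/-- The previous plaquette index `c - e`. [folklore] -/
private theorem eq_rectShift_iff'' (c c' : Fin M × Fin M') (e : Fin 2) :
    c = rectShift c' e ↔ c' = c - rectDir e := by
  rw [rectShift, eq_sub_iff_add_eq, eq_comm]

/-- The previous diagonal plaquette index `c - (1, ±1)`. [folklore] -/
private theorem eq_rectCornerShift_iff (c c' : Fin M × Fin M') (d : Fin 2) :
    c = rectCornerShift c' d ↔ c' = c - rectCornerDir d := by
  rw [rectCornerShift, eq_sub_iff_add_eq, eq_comm]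

omit [NeZero M] [NeZero M'] in
/-- Collapsing the plaquette sum on the cell terms `[c' = c ∧ Q b]`. [folklore] -/
private theorem sum_ite_eq_and (c : Fin M × Fin M') (Q : FermionTorus 2 2 → Prop) [DecidablePred Q]
    (G : Fin M × Fin M' → FermionTorus 2 2 → β) :
    (∑ c' : Fin M × Fin M', ∑ b : FermionTorus 2 2, if c' = c ∧ Q b then G c' b else 0) =
      ∑ b : FermionTorus 2 2, if Q b then G c b else 0 := by
  rw [Finset.sum_comm]
  refine Finset.sum_congr rfl fun b _ => ?_
  simp only [ite_and]
  rw [Finset.sum_ite_eq' univ c, if_pos (mem_univ _)]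

omit [NeZero M] [NeZero M'] in
/-- Collapsing the plaquette sum on link terms `[R c' e ∧ L e b]` when `R c' e ↔ c' = g e`.
[folklore] -/
private theorem sum_ite_rel_and (R : Fin M × Fin M' → Fin 2 → Prop) [∀ c' e, Decidable (R c' e)]
    (g : Fin 2 → Fin M × Fin M') (hR : ∀ c' e, R c' e ↔ c' = g e)
    (L : Fin 2 → FermionTorus 2 2 → Prop) [∀ e b, Decidable (L e b)]
    (G : Fin M × Fin M' → FermionTorus 2 2 → β) :
    (∑ c' : Fin M × Fin M', ∑ b : FermionTorus 2 2, ∑ e : Fin 2, if R c' e ∧ L e b then G c' b else 0) =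
      ∑ e : Fin 2, ∑ b : FermionTorus 2 2, if L e b then G (g e) b else 0 := by
  rw [sum_sum_sum_comm]
  refine Finset.sum_congr rfl fun e _ => ?_
  rw [Finset.sum_comm]
  refine Finset.sum_congr rfl fun b _ => ?_
  simp only [hR, ite_and]
  rw [Finset.sum_ite_eq' univ (g e), if_pos (mem_univ _)]

/-- The nearest-neighbour bonds starting at a fixed site, in cell coordinates: intra-plaquette
edges, middle bonds to the next plaquette `c + e`, middle bonds to the previous plaquette `c - e`.
[folklore] -/
private theorem sum_ite_rectAdj_cellSite_eq (hM : 2 ≤ M) (hM' : 2 ≤ M')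
    (X : Fin (M * 2) ×ₗ Fin (M' * 2) → Fin (M * 2) ×ₗ Fin (M' * 2) → β)
    (c : Fin M × Fin M') (a : FermionTorus 2 2) :
    (∑ y, if (fermionRectTorusGraph (M * 2) (M' * 2)).Adj (rectCellSite c a) y then X (rectCellSite c a) y else 0) =
      (∑ b : FermionTorus 2 2, if plaquetteGraph.Adj a b then X (rectCellSite c a) (rectCellSite c b) else 0) +
        ∑ e : Fin 2, ((∑ b : FermionTorus 2 2,
            if LinkMid e a b then X (rectCellSite c a) (rectCellSite (rectShift c e) b) else 0) +
          ∑ b : FermionTorus 2 2,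
            if LinkMid e b a then X (rectCellSite c a) (rectCellSite (c - rectDir e) b) else 0) := by
  rw [sum_rectCellSite'']
  simp_rw [ite_rectAdj_cellSite_eq hM hM']
  simp only [Finset.sum_add_distrib]
  rw [sum_ite_eq_and c _ fun c' b => X (rectCellSite c a) (rectCellSite c' b),
    sum_ite_rel_and (fun c' e => c' = rectShift c e) (fun e => rectShift c e) (fun _ _ => Iff.rfl) _
      fun c' b => X (rectCellSite c a) (rectCellSite c' b),
    sum_ite_rel_and (fun c' e => c = rectShift c' e) (fun e => c - rectDir e) (fun c' e => eq_rectShift_iff'' c c' e)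
      (fun e b => LinkMid e b a) fun c' b => X (rectCellSite c a) (rectCellSite c' b)]

/-- The diagonal bonds starting at a fixed site, in cell coordinates: plaquette diagonals, diagonal
bonds to the next / previous axial plaquette `c ± e`, corner bonds to the next / previous diagonal
plaquette `c ± (1, ±1)`. [folklore] -/
private theorem sum_ite_rectDiagAdj_cellSite_eq (hM : 2 ≤ M) (hM' : 2 ≤ M')
    (X : Fin (M * 2) ×ₗ Fin (M' * 2) → Fin (M * 2) ×ₗ Fin (M' * 2) → β)
    (c : Fin M × Fin M') (a : FermionTorus 2 2) :
    (∑ y, if (fermionRectTorusDiagGraph (M * 2) (M' * 2)).Adj (rectCellSite c a) y then X (rectCellSite c a) y else 0) =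
      (∑ b : FermionTorus 2 2, if plaquetteDiagGraph.Adj a b then X (rectCellSite c a) (rectCellSite c b) else 0) +
        ∑ e : Fin 2, ((∑ b : FermionTorus 2 2,
            if LinkDiag e a b then X (rectCellSite c a) (rectCellSite (rectShift c e) b) else 0) +
          ∑ b : FermionTorus 2 2,
            if LinkDiag e b a then X (rectCellSite c a) (rectCellSite (c - rectDir e) b) else 0) +
        ∑ d : Fin 2, ((∑ b : FermionTorus 2 2,
            if CornerPair d a b then X (rectCellSite c a) (rectCellSite (rectCornerShift c d) b) else 0) +
          ∑ b : FermionTorus 2 2,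
            if CornerPair d b a then X (rectCellSite c a) (rectCellSite (c - rectCornerDir d) b) else 0) := by
  rw [sum_rectCellSite'']
  simp_rw [ite_rectDiagAdj_cellSite_eq hM hM']
  simp only [Finset.sum_add_distrib]
  rw [sum_ite_eq_and c _ fun c' b => X (rectCellSite c a) (rectCellSite c' b),
    sum_ite_rel_and (fun c' e => c' = rectShift c e) (fun e => rectShift c e) (fun _ _ => Iff.rfl) _
      fun c' b => X (rectCellSite c a) (rectCellSite c' b),
    sum_ite_rel_and (fun c' e => c = rectShift c' e) (fun e => c - rectDir e) (fun c' e => eq_rectShift_iff'' c c' e)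
      (fun e b => LinkDiag e b a) fun c' b => X (rectCellSite c a) (rectCellSite c' b),
    sum_ite_rel_and (fun c' d => c' = rectCornerShift c d) (fun d => rectCornerShift c d) (fun _ _ => Iff.rfl) _
      fun c' b => X (rectCellSite c a) (rectCellSite c' b),
    sum_ite_rel_and (fun c' d => c = rectCornerShift c' d) (fun d => c - rectCornerDir d)
      (fun c' d => eq_rectCornerShift_iff c c' d)
      (fun d b => CornerPair d b a) fun c' b => X (rectCellSite c a) (rectCellSite c' b)]

/-- Sums over the window `{0,1} × {0,1}²` in copy coordinates. [folklore] -/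
private theorem sum_window'' (g : Fin 2 ×ₗ FermionTorus 2 2 → β) :
    ∑ p, g p = ∑ i : Fin 2, ∑ a : FermionTorus 2 2, g (toLex (i, a)) := by
  rw [← (toLex : Fin 2 × FermionTorus 2 2 ≃ Fin 2 ×ₗ FermionTorus 2 2).sum_comp, Fintype.sum_prod_type]

/-- Sums over the window against the diagonal link graph: the two diagonal bonds, in both
orientations. [folklore] -/
private theorem sum_ite_linkDiagGraph_eq'' (e : Fin 2) (Y : Fin 2 ×ₗ FermionTorus 2 2 → Fin 2 ×ₗ FermionTorus 2 2 → β) :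
    ∑ p, ∑ q, (if (linkDiagGraph e).Adj p q then Y p q else 0) =
      (∑ a : FermionTorus 2 2, ∑ b : FermionTorus 2 2,
          if LinkDiag e a b then Y (toLex (0, a)) (toLex (1, b)) else 0) +
        ∑ a : FermionTorus 2 2, ∑ b : FermionTorus 2 2,
          if LinkDiag e b a then Y (toLex (1, a)) (toLex (0, b)) else 0 := by
  rw [sum_window'']
  have hinner : ∀ i a, (∑ q, if (linkDiagGraph e).Adj (toLex (i, a)) q then Y (toLex (i, a)) q else 0) =
      ∑ j : Fin 2, ∑ b : FermionTorus 2 2,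
        if (linkDiagGraph e).Adj (toLex (i, a)) (toLex (j, b)) then Y (toLex (i, a)) (toLex (j, b)) else 0 :=
    fun i a => sum_window'' _
  simp_rw [hinner]
  simp only [linkDiagGraph_adj'', ofLex_toLex, Fin.sum_univ_two, Fin.isValue]
  simp

/-- Sums over the window against the corner link graph: the corner bond, in both orientations.
[folklore] -/
private theorem sum_ite_cornerGraph_eq'' (d : Fin 2) (Y : Fin 2 ×ₗ FermionTorus 2 2 → Fin 2 ×ₗ FermionTorus 2 2 → β) :
    ∑ p, ∑ q, (if (cornerGraph d).Adj p q then Y p q else 0) =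
      (∑ a : FermionTorus 2 2, ∑ b : FermionTorus 2 2,
          if CornerPair d a b then Y (toLex (0, a)) (toLex (1, b)) else 0) +
        ∑ a : FermionTorus 2 2, ∑ b : FermionTorus 2 2,
          if CornerPair d b a then Y (toLex (1, a)) (toLex (0, b)) else 0 := by
  rw [sum_window'']
  have hinner : ∀ i a, (∑ q, if (cornerGraph d).Adj (toLex (i, a)) q then Y (toLex (i, a)) q else 0) =
      ∑ j : Fin 2, ∑ b : FermionTorus 2 2,
        if (cornerGraph d).Adj (toLex (i, a)) (toLex (j, b)) then Y (toLex (i, a)) (toLex (j, b)) else 0 :=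
    fun i a => sum_window'' _
  simp_rw [hinner]
  simp only [cornerGraph_adj'', ofLex_toLex, Fin.sum_univ_two, Fin.isValue]
  simp

/-- **Tiling of the nearest-neighbour torus bonds** (iterated form): a sum over the ordered
nearest-neighbour pairs of `(ℤ/2M) × (ℤ/2M')` is the sum over the ordered plaquette edges plus, for
every plaquette `c` and direction `e`, the two middle bonds to the plaquette `c + e` in both
orientations. [folklore] -/
private theorem sum_ite_rectAdj_eq_iter (hM : 2 ≤ M) (hM' : 2 ≤ M')
    (X : Fin (M * 2) ×ₗ Fin (M' * 2) → Fin (M * 2) ×ₗ Fin (M' * 2) → β) :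
    ∑ x, ∑ y, (if (fermionRectTorusGraph (M * 2) (M' * 2)).Adj x y then X x y else 0) =
      ∑ c : Fin M × Fin M', ∑ a : FermionTorus 2 2, ∑ b : FermionTorus 2 2,
          (if plaquetteGraph.Adj a b then X (rectCellSite c a) (rectCellSite c b) else 0) +
        ∑ c : Fin M × Fin M', ∑ e : Fin 2,
          ((∑ a : FermionTorus 2 2, ∑ b : FermionTorus 2 2,
              if LinkMid e a b then X (rectCellSite c a) (rectCellSite (rectShift c e) b) else 0) +
            ∑ a : FermionTorus 2 2, ∑ b : FermionTorus 2 2,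
              if LinkMid e b a then X (rectCellSite (rectShift c e) a) (rectCellSite c b) else 0) := by
  rw [sum_rectCellSite'']
  simp_rw [sum_ite_rectAdj_cellSite_eq hM hM' X]
  simp only [Finset.sum_add_distrib]
  congr 1
  congr 1
  · refine Finset.sum_congr rfl fun c _ => ?_
    rw [Finset.sum_comm]
  · -- reindex the plaquette sum `c ↦ c + e` in the second family of link terms
    rw [sum_sum_sum_comm]
    conv_rhs => rw [Finset.sum_comm]
    refine Finset.sum_congr rfl fun e _ => ?_
    rw [← Equiv.sum_comp (Equiv.addRight (rectDir (M := M) (M' := M') e))]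
    refine Finset.sum_congr rfl fun c _ => ?_
    simp only [Equiv.coe_addRight, add_sub_cancel_right]
    rfl

/-- **Tiling of the nearest-neighbour torus bonds** (window form): the link bonds of the axial
link `ℓ = (c, e)` are the edges of `linkGraph e` on the window `rectLinkEmb c e`. [folklore] -/
private theorem sum_ite_rectAdj_eq (hM : 2 ≤ M) (hM' : 2 ≤ M')
    (X : Fin (M * 2) ×ₗ Fin (M' * 2) → Fin (M * 2) ×ₗ Fin (M' * 2) → β) :
    ∑ x, ∑ y, (if (fermionRectTorusGraph (M * 2) (M' * 2)).Adj x y then X x y else 0) =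
      ∑ c : Fin M × Fin M', ∑ a : FermionTorus 2 2, ∑ b : FermionTorus 2 2,
          (if plaquetteGraph.Adj a b then X (rectCellSite c a) (rectCellSite c b) else 0) +
        ∑ ℓ : (Fin M × Fin M') × Fin 2, ∑ p, ∑ q,
          (if (linkGraph ℓ.2).Adj p q then X (rectLinkEmb hM hM' ℓ.1 ℓ.2 p) (rectLinkEmb hM hM' ℓ.1 ℓ.2 q) else 0) := by
  rw [sum_ite_rectAdj_eq_iter hM hM' X, Fintype.sum_prod_type (fun ℓ : (Fin M × Fin M') × Fin 2 => ∑ p, ∑ q,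
    (if (linkGraph ℓ.2).Adj p q then X (rectLinkEmb hM hM' ℓ.1 ℓ.2 p) (rectLinkEmb hM hM' ℓ.1 ℓ.2 q) else 0))]
  congr 1
  refine Finset.sum_congr rfl fun c _ => Finset.sum_congr rfl fun e _ => ?_
  rw [sum_ite_linkGraph_eq]
  simp only [rectLinkEmb_apply'', ofLex_toLex, Fin.isValue, ↓reduceIte, one_ne_zero]

/-- **Tiling of the diagonal torus bonds** (iterated form): a sum over the ordered
next-nearest-neighbour pairs of `(ℤ/2M) × (ℤ/2M')` is the sum over the ordered plaquette diagonals
plus, for every plaquette `c` and direction `e`, the two diagonal bonds to the plaquette `c + e`,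
plus, for every plaquette `c` and kind `d`, the corner bond to the plaquette `c + (1, ±1)` (all in
both orientations). [folklore] -/
private theorem sum_ite_rectDiagAdj_eq_iter (hM : 2 ≤ M) (hM' : 2 ≤ M')
    (X : Fin (M * 2) ×ₗ Fin (M' * 2) → Fin (M * 2) ×ₗ Fin (M' * 2) → β) :
    ∑ x, ∑ y, (if (fermionRectTorusDiagGraph (M * 2) (M' * 2)).Adj x y then X x y else 0) =
      ∑ c : Fin M × Fin M', ∑ a : FermionTorus 2 2, ∑ b : FermionTorus 2 2,
          (if plaquetteDiagGraph.Adj a b then X (rectCellSite c a) (rectCellSite c b) else 0) +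
        ∑ c : Fin M × Fin M', ∑ e : Fin 2,
          ((∑ a : FermionTorus 2 2, ∑ b : FermionTorus 2 2,
              if LinkDiag e a b then X (rectCellSite c a) (rectCellSite (rectShift c e) b) else 0) +
            ∑ a : FermionTorus 2 2, ∑ b : FermionTorus 2 2,
              if LinkDiag e b a then X (rectCellSite (rectShift c e) a) (rectCellSite c b) else 0) +
        ∑ c : Fin M × Fin M', ∑ d : Fin 2,
          ((∑ a : FermionTorus 2 2, ∑ b : FermionTorus 2 2,
              if CornerPair d a b then X (rectCellSite c a) (rectCellSite (rectCornerShift c d) b) else 0) +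
            ∑ a : FermionTorus 2 2, ∑ b : FermionTorus 2 2,
              if CornerPair d b a then X (rectCellSite (rectCornerShift c d) a) (rectCellSite c b) else 0) := by
  rw [sum_rectCellSite'']
  simp_rw [sum_ite_rectDiagAdj_cellSite_eq hM hM' X]
  simp only [Finset.sum_add_distrib]
  congr 1
  · congr 1
    congr 1
    · refine Finset.sum_congr rfl fun c _ => ?_
      rw [Finset.sum_comm]
    · rw [sum_sum_sum_comm]
      conv_rhs => rw [Finset.sum_comm]
      refine Finset.sum_congr rfl fun e _ => ?_
      rw [← Equiv.sum_comp (Equiv.addRight (rectDir (M := M) (M' := M') e))]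
      refine Finset.sum_congr rfl fun c _ => ?_
      simp only [Equiv.coe_addRight, add_sub_cancel_right]
      rfl
  · congr 1
    · refine Finset.sum_congr rfl fun c _ => ?_
      rw [Finset.sum_comm]
    · rw [sum_sum_sum_comm]
      conv_rhs => rw [Finset.sum_comm]
      refine Finset.sum_congr rfl fun d _ => ?_
      rw [← Equiv.sum_comp (Equiv.addRight (rectCornerDir (M := M) (M' := M') d))]
      refine Finset.sum_congr rfl fun c _ => ?_
      simp only [Equiv.coe_addRight, add_sub_cancel_right]
      rfl

/-- **Tiling of the diagonal torus bonds** (window form): the diagonal bonds of the axial link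
`(c, e)` are the edges of `linkDiagGraph e` on the window `rectLinkEmb c e`, the corner bond of the
corner link `(c, d)` is the edge of `cornerGraph d` on the window `rectCornerEmb c d`. [folklore] -/
private theorem sum_ite_rectDiagAdj_eq (hM : 2 ≤ M) (hM' : 2 ≤ M')
    (X : Fin (M * 2) ×ₗ Fin (M' * 2) → Fin (M * 2) ×ₗ Fin (M' * 2) → β) :
    ∑ x, ∑ y, (if (fermionRectTorusDiagGraph (M * 2) (M' * 2)).Adj x y then X x y else 0) =
      ∑ c : Fin M × Fin M', ∑ a : FermionTorus 2 2, ∑ b : FermionTorus 2 2,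
          (if plaquetteDiagGraph.Adj a b then X (rectCellSite c a) (rectCellSite c b) else 0) +
        ∑ ℓ : (Fin M × Fin M') × Fin 2, ∑ p, ∑ q,
          (if (linkDiagGraph ℓ.2).Adj p q then X (rectLinkEmb hM hM' ℓ.1 ℓ.2 p) (rectLinkEmb hM hM' ℓ.1 ℓ.2 q)
            else 0) +
        ∑ ℓ : (Fin M × Fin M') × Fin 2, ∑ p, ∑ q,
          (if (cornerGraph ℓ.2).Adj p q then X (rectCornerEmb hM ℓ.1 ℓ.2 p) (rectCornerEmb hM ℓ.1 ℓ.2 q)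
            else 0) := by
  rw [sum_ite_rectDiagAdj_eq_iter hM hM' X, Fintype.sum_prod_type (fun ℓ : (Fin M × Fin M') × Fin 2 => ∑ p, ∑ q,
    (if (linkDiagGraph ℓ.2).Adj p q then X (rectLinkEmb hM hM' ℓ.1 ℓ.2 p) (rectLinkEmb hM hM' ℓ.1 ℓ.2 q) else 0)),
    Fintype.sum_prod_type (fun ℓ : (Fin M × Fin M') × Fin 2 => ∑ p, ∑ q,
    (if (cornerGraph ℓ.2).Adj p q then X (rectCornerEmb hM ℓ.1 ℓ.2 p) (rectCornerEmb hM ℓ.1 ℓ.2 q) else 0))]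
  congr 1
  · congr 1
    refine Finset.sum_congr rfl fun c _ => Finset.sum_congr rfl fun e _ => ?_
    rw [sum_ite_linkDiagGraph_eq'']
    simp only [rectLinkEmb_apply'', ofLex_toLex, Fin.isValue, ↓reduceIte, one_ne_zero]
  · refine Finset.sum_congr rfl fun c _ => Finset.sum_congr rfl fun d _ => ?_
    rw [sum_ite_cornerGraph_eq'']
    simp only [rectCornerEmb_apply, ofLex_toLex, Fin.isValue, ↓reduceIte, one_ne_zero]

end Sums

/-! ### §5. The bond partition of the torus `t–t'` Hamiltonian -/

/-- **Bond partition of the `t–t'` Hamiltonian of the torus `(ℤ/2M) × (ℤ/2M')`** (`M, M' ≥ 2`):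
`H = Σ_c Γ(rectCellEmb c)(H_plaq(t,U) + D_plaq(t')) + (Σ_{(c,e)} Γ(rectLinkEmb c e)(T_e(t) + D_e(t'))
  + Σ_{(c,d)} Γ(rectCornerEmb c d) C_d(t'))`, with `H_plaq = hamiltonian plaquetteGraph t U`,
`D_plaq = hamiltonian plaquetteDiagGraph t' 0`, `T_e = hamiltonian (linkGraph e) t 0`,
`D_e = hamiltonian (linkDiagGraph e) t' 0`, `C_d = hamiltonian (cornerGraph d) t' 0`. [folklore] -/
private theorem rectTT'_hamiltonian_eq_sum_cells_add_sum_links (hM : 2 ≤ M) (hM' : 2 ≤ M') (t t' U : ℝ) :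
    hubbardRectTorusTT' (M * 2) (M' * 2) t t' U =
      ∑ c : Fin M × Fin M', fermionEmbed (rectCellEmb c)
          (hamiltonian plaquetteGraph t U + hamiltonian plaquetteDiagGraph t' 0) +
        (∑ ℓ : (Fin M × Fin M') × Fin 2, fermionEmbed (rectLinkEmb hM hM' ℓ.1 ℓ.2)
            (hamiltonian (linkGraph ℓ.2) t 0 + hamiltonian (linkDiagGraph ℓ.2) t' 0) +
          ∑ ℓ : (Fin M × Fin M') × Fin 2, fermionEmbed (rectCornerEmb hM ℓ.1 ℓ.2)
            (hamiltonian (cornerGraph ℓ.2) t' 0)) := by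
  rw [hubbardRectTorusTT', hamiltonian, hamiltonian]
  simp only [sum_ite_const_cond]
  rw [sum_ite_rectAdj_eq hM hM', sum_ite_rectDiagAdj_eq hM hM',
    sum_rectCellSite'' (fun x => numberOp x 0 * numberOp x 1)]
  simp only [fermionEmbed_add, fermionEmbed_hamiltonian, rectCellEmb_apply'', Complex.ofReal_zero, zero_smul,
    add_zero, sum_ite_const_cond, Finset.sum_add_distrib, ← Finset.smul_sum, smul_add]
  abel

/-! ### §6. The bound -/

set_option maxHeartbeats 800000 in
/-- **The plaquette-dressed Slater (local-unitary-cluster) bound on the rectangular torus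
`(ℤ/2M) × (ℤ/2M')` with `t–t'` hopping, `M, M' ≥ 2`.** For all real `t, t', U`, every orthogonal
projection `P` on the one-particle space of the torus with `tr P = N`, and every family of
particle-number conserving unitaries `u_c` of the plaquette Fock space (`u_cᴴ u_c = 1`,
`[N̂, u_c] = 0`),
`E_{2M×2M'}(t,t',U;N) ≤ Re [ Σ_c Σ_{s,t} (u_cᴴ (H_plaq + D_plaq) u_c)_{st} · slaterRDM (P|_{cell c}) s t
   + Σ_{(c,e)} Σ_{s,t} (V_{c,e}ᴴ (T_e + D_e) V_{c,e})_{st} · slaterRDM (P|_{rectLinkEmb c e}) s t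
   + Σ_{(c,d)} Σ_{s,t} (W_{c,d}ᴴ C_d W_{c,d})_{st} · slaterRDM (P|_{rectCornerEmb c d}) s t ]`,
`V_{c,e} = Γ(inlCell) u_c · Γ(inrCell) u_{c+e}`, `W_{c,d} = Γ(inlCell) u_c · Γ(inrCell) u_{c+(1,±1)}`:
the energy of the dressed Slater determinant `(∏_c Γ(rectCellEmb c) u_c) Φ_P`, an explicit
polynomial in the window entries of `P` and the entries of the `u_c`
(`DressedCluster.groundEnergy_le` + the bond partition). At `t' = 0` the diagonal window operators
`D_plaq, D_e, C_d` vanish and the statement is `groundEnergyAt_rect_le_dressed`.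
[cite: BachLiebSolovej1994, eq. (2c.36)] -/
theorem groundEnergy_rectTT'_le_dressed (hM : 2 ≤ M) (hM' : 2 ≤ M') (t t' U : ℝ)
    {P : Matrix (Orb (Fin (M * 2) ×ₗ Fin (M' * 2))) (Orb (Fin (M * 2) ×ₗ Fin (M' * 2))) ℂ}
    (hP : P.IsHermitian) (hPP : P * P = P) {N : ℕ} (htr : P.trace = N)
    (u : Fin M × Fin M' → Matrix (Finset (Orb (FermionTorus 2 2))) (Finset (Orb (FermionTorus 2 2))) ℂ)
    (hu : ∀ c, (u c)ᴴ * u c = 1) (huN : ∀ c, Commute totalNumberOp (u c)) :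
    groundEnergy (hubbardRectTorusTT' (M * 2) (M' * 2) t t' U) N ≤
      ((∑ c : Fin M × Fin M', ∑ s : Finset (Orb (FermionTorus 2 2)), ∑ s' : Finset (Orb (FermionTorus 2 2)),
          ((u c)ᴴ * (hamiltonian plaquetteGraph t U + hamiltonian plaquetteDiagGraph t' 0) * u c) s s' *
            HartreeFock.slaterRDM (P.submatrix (fun a => orb (rectCellEmb c (ofLex a).1) (ofLex a).2)
              (fun a => orb (rectCellEmb c (ofLex a).1) (ofLex a).2)) s s') +
        (∑ ℓ : (Fin M × Fin M') × Fin 2, ∑ s : Finset (Orb (Fin 2 ×ₗ FermionTorus 2 2)),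
            ∑ s' : Finset (Orb (Fin 2 ×ₗ FermionTorus 2 2)),
              ((fermionEmbed inlCell (u ℓ.1) * fermionEmbed inrCell (u (rectShift ℓ.1 ℓ.2)))ᴴ *
                  (hamiltonian (linkGraph ℓ.2) t 0 + hamiltonian (linkDiagGraph ℓ.2) t' 0) *
                (fermionEmbed inlCell (u ℓ.1) * fermionEmbed inrCell (u (rectShift ℓ.1 ℓ.2)))) s s' *
              HartreeFock.slaterRDM (P.submatrix (fun a => orb (rectLinkEmb hM hM' ℓ.1 ℓ.2 (ofLex a).1) (ofLex a).2)
                (fun a => orb (rectLinkEmb hM hM' ℓ.1 ℓ.2 (ofLex a).1) (ofLex a).2)) s s' +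
          ∑ ℓ : (Fin M × Fin M') × Fin 2, ∑ s : Finset (Orb (Fin 2 ×ₗ FermionTorus 2 2)),
            ∑ s' : Finset (Orb (Fin 2 ×ₗ FermionTorus 2 2)),
              ((fermionEmbed inlCell (u ℓ.1) * fermionEmbed inrCell (u (rectCornerShift ℓ.1 ℓ.2)))ᴴ *
                  hamiltonian (cornerGraph ℓ.2) t' 0 *
                (fermionEmbed inlCell (u ℓ.1) * fermionEmbed inrCell (u (rectCornerShift ℓ.1 ℓ.2)))) s s' *
              HartreeFock.slaterRDM (P.submatrix (fun a => orb (rectCornerEmb hM ℓ.1 ℓ.2 (ofLex a).1) (ofLex a).2)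
                (fun a => orb (rectCornerEmb hM ℓ.1 ℓ.2 (ofLex a).1) (ofLex a).2)) s s')).re := by
  have hH := rectTT'_hamiltonian_eq_sum_cells_add_sum_links hM hM' t t' U
  have h := DressedCluster.groundEnergy_le (φ := rectCellEmb) (hdisj := fun _ _ h => disjoint_rectCellEmb'' h)
    (u := u) (huN := huN) (D := ((Fin M × Fin M') × Fin 2) ⊕ ((Fin M × Fin M') × Fin 2))
    (ψ := Sum.elim (fun ℓ => rectLinkEmb hM hM' ℓ.1 ℓ.2) (fun ℓ => rectCornerEmb hM ℓ.1 ℓ.2))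
    (src := Sum.elim (fun ℓ => ℓ.1) (fun ℓ => ℓ.1))
    (tgt := Sum.elim (fun ℓ => rectShift ℓ.1 ℓ.2) (fun ℓ => rectCornerShift ℓ.1 ℓ.2))
    (ι₁ := inlCell) (ι₂ := inrCell)
    (hne := by
      rintro (ℓ | ℓ)
      exacts [(rectShift_ne'' hM hM' ℓ.1 ℓ.2).symm, (rectCornerShift_ne hM ℓ.1 ℓ.2).symm])
    (hsrc := by
      rintro (ℓ | ℓ)
      exacts [inlCell_trans_rectLinkEmb'' hM hM' ℓ.1 ℓ.2, inlCell_trans_rectCornerEmb hM ℓ.1 ℓ.2])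
    (htgt := by
      rintro (ℓ | ℓ)
      exacts [inrCell_trans_rectLinkEmb'' hM hM' ℓ.1 ℓ.2, inrCell_trans_rectCornerEmb hM ℓ.1 ℓ.2])
    (hcover := mem_range_inlCell_or_inrCell)
    hP hPP htr (hu := fun c => by convert hu c) (H := hubbardRectTorusTT' (M * 2) (M' * 2) t t' U)
    (h₁ := fun _ => hamiltonian plaquetteGraph t U + hamiltonian plaquetteDiagGraph t' 0)
    (h₂ := Sum.elim (fun ℓ => hamiltonian (linkGraph ℓ.2) t 0 + hamiltonian (linkDiagGraph ℓ.2) t' 0)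
      (fun ℓ => hamiltonian (cornerGraph ℓ.2) t' 0))
    (by rw [hH]; simp only [Fintype.sum_sum_type, Sum.elim_inl, Sum.elim_inr])
  simp only [Fintype.sum_sum_type, Sum.elim_inl, Sum.elim_inr] at h
  convert h using 3

end PlaquetteLUC

end Literature.MathematicalPhysics.QuantumLattice

end
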